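import Mathlib
import HarnessLib
import Literature.MathematicalPhysics.StatisticalMechanics.Crystallization
import Literature.MathematicalPhysics.StatisticalMechanics.BarlowStacking
import Literature.Geometry.DiscreteGeometry.KissingPatterns
import Summits.AtomisticToContinuum.Crystallization.Theses.ReggeStarCoercivity

/-!
# Sketch — crux-ideate round 1, ideator 2, crux `ReggeStarCoercivity.PeriodicStarCoercivity`
(item stmt-AtomisticToContinuum-13602)

First lemmas of the idea cards in `Ideas/`:

* card `same-word-reference-phonon-gap`  → `NearRegimeCoercivity`, `comparative_principle`
* card `pinned-equilibria-reduction`      → `DescentToEquilibria`, `reduction_to_equilibria`,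
                                            `OneSiteCuts`

Everything is stated over existing declarations (`PeriodicConfiguration`, `energyPerParticle`,
`lennardJones`, `ShellCloseTo`, `fccKissingPattern`, `hcpKissingPattern`); the two `theorem`s are
the purely logical parts of the levers and are proved here (no sorry).
-/

noncomputable section

open scoped BigOperators Classical
open Literature.MathematicalPhysics.StatisticalMechanics Literature.Geometry.DiscreteGeometry

namespace Summit.AtomisticToContinuum.Crystallization.Cruxes.PeriodicStarCoercivity.Sketch

local notation "E3" => EuclideanSpace ℝ (Fin 3)

/-! ## The crux's vocabulary, named -/

/-- The recentred first shell (radius `6/5`) of a point `s`, read in the point set of `P` and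
rescaled by `a⁻¹` — verbatim the sub-term of the crux decl. -/
def shell (P : PeriodicConfiguration 3) (s : E3) (a : ℝ) : Finset E3 :=
  (P.finite_inter_points (K := Metric.closedBall s (6 / 5) \ {s})
      (Metric.isBounded_closedBall.subset Set.sdiff_subset)).toFinset.image fun y => a⁻¹ • (y - s)

/-- `s` is `η`-close to a Barlow shell at some admissible dilation `a ∈ [9/10, 11/10]`
(the crux uses `η = 1/20`; the near regime of card 1 uses `η₁ = 7/100`). -/
def NearBarlow (η : ℝ) (P : PeriodicConfiguration 3) (s : E3) : Prop :=
  ∃ a : ℝ, 9 / 10 ≤ a ∧ a ≤ 11 / 10 ∧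
    (ShellCloseTo η (shell P s a) fccKissingPattern ∨ ShellCloseTo η (shell P s a) hcpKissingPattern)

/-- Fraction of `1/20`-defective motif points (the crux's charge). -/
def defectFraction (P : PeriodicConfiguration 3) : ℝ :=
  ((P.motif.filter fun s => ¬ NearBarlow (1 / 20) P s).card : ℝ) / (P.motif.card : ℝ)

/-- `e_per`, the periodic infimum of the Lennard-Jones energy per particle. -/
def ePer : ℝ := ⨅ Q : PeriodicConfiguration 3, Q.energyPerParticle lennardJones

/-- The crux, restated with the named vocabulary (same normal form as the route decl up to
`g * (a / b) = g * a / b`). -/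
def Crux : Prop :=
  ∃ g : ℝ, 0 < g ∧ ∀ P : PeriodicConfiguration 3,
    ePer + g * defectFraction P ≤ P.energyPerParticle lennardJones

/-- The named restatement IS the route decl (the crux is fixed; this only checks the reading). -/
theorem crux_iff :
    Crux ↔ Summit.AtomisticToContinuum.Crystallization.Theses.ReggeStarCoercivity.PeriodicStarCoercivity := by
  unfold Crux defectFraction NearBarlow shell ePer
    Summit.AtomisticToContinuum.Crystallization.Theses.ReggeStarCoercivity.PeriodicStarCoercivity
  simp only [mul_div_assoc]

/-! ## Card 1 — same-word reference + phonon gap -/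

/-- **First lemma of card 1 (near-regime coercivity).** If EVERY motif point of a periodic
configuration is `7/100`-close to a Barlow shell, then the `1/20`-defective ones are charged at a
uniform rate `c > 0` above the periodic infimum. Intended proof: compare `P` with the relaxation
`P♮` of ITS OWN stacking word (a periodic configuration, so `e(P♮) ≥ ePer` for free — no stacking
selection), and bound `e(P) - e(P♮)` below by the certified phonon gap of Lennard-Jones Barlow
stackings against the shell-distortion form (kit job j005244). -/
def NearRegimeCoercivity : Prop :=
  ∃ c : ℝ, 0 < c ∧ ∀ P : PeriodicConfiguration 3,
    (∀ s ∈ P.motif, NearBarlow (7 / 100) P s) →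
      ePer + c * defectFraction P ≤ P.energyPerParticle lennardJones

/-- **The comparative principle (the lever of card 1, pure logic).** To charge the defects of `P`
at rate `c` it suffices to exhibit ANY periodic competitor `Q` that beats `P` by `c · φ(P)`; the
unknown constant `ePer` never has to be evaluated. (`hbdd` is the shared item 0714
`CrysPeriodicBddBelow`, true by Lennard-Jones stability.) -/
theorem comparative_principle
    (hbdd : BddBelow (Set.range fun Q : PeriodicConfiguration 3 => Q.energyPerParticle lennardJones))
    {c : ℝ} {P Q : PeriodicConfiguration 3}
    (hQ : Q.energyPerParticle lennardJones + c * defectFraction P ≤ P.energyPerParticle lennardJones) :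
    ePer + c * defectFraction P ≤ P.energyPerParticle lennardJones := by
  have h1 : ePer ≤ Q.energyPerParticle lennardJones := ciInf_le hbdd Q
  linarith

/-! ## Card 2 — pinned equilibria (vary the competitor, not the bound) -/

/-- The force on the sublattice `s + G` of a periodic configuration (minus the gradient in `s` of
the energy per cell, up to the factor `#F`): `∑_{y ∉ s + G} V'(|s-y|) (y - s)/|s - y|`
(points of the same sublattice co-move and drop out). -/
def force (P : PeriodicConfiguration 3) (s : E3) : E3 :=
  ∑' y : {y : E3 // y ∈ P.points ∧ y - s ∉ P.lattice},
    (deriv lennardJones (dist s y.1) / dist s y.1) • (y.1 - s)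

/-- The point set of `P` with the sublattice through `s` moved to pass through `t`. -/
def replacePts (P : PeriodicConfiguration 3) (s t : E3) : Set E3 :=
  {z | z ∈ P.points ∧ z - s ∉ P.lattice} ∪ {z | z - t ∈ P.lattice}

/-- Shell of `s` read in an arbitrary point set `S` (as a set). -/
def shellSet (S : Set E3) (s : E3) (a : ℝ) : Set E3 :=
  (fun y => a⁻¹ • (y - s)) '' (S ∩ (Metric.closedBall s (6 / 5) \ {s}))

/-- `NearBarlow` for an arbitrary point set (finiteness of the shell demanded inside). -/
def NearBarlowSet (η : ℝ) (S : Set E3) (s : E3) : Prop :=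
  ∃ a : ℝ, 9 / 10 ≤ a ∧ a ≤ 11 / 10 ∧ ∃ hfin : (shellSet S s a).Finite,
    ShellCloseTo η hfin.toFinset fccKissingPattern ∨ ShellCloseTo η hfin.toFinset hcpKissingPattern

/-- `s` is `ρ`-ROBUSTLY classified in `P`: moving the sublattice of `s` by less than `ρ` changes
the `1/20`-defect status of no motif point (so `s` is not "pinned" at a matching threshold, nor is
any neighbour's status decided by `s` sitting at a threshold). -/
def Robust (ρ : ℝ) (P : PeriodicConfiguration 3) (s : E3) : Prop :=
  ∀ t : E3, dist t s < ρ → ∀ s' ∈ P.motif,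
    (NearBarlowSet (1 / 20) P.points s' ↔
      NearBarlowSet (1 / 20) (replacePts P s t) (if s' = s then t else s'))

/-- **First lemma of card 2 (descent to pinned equilibria; Ekeland / constrained gradient flow in
the finite-dimensional space of motifs with a fixed lattice).** For every `g ≥ 0`, every periodic
`P` and all `ε, ρ > 0` there is a competitor `P'` with the same lattice and motif size that is at
least as bad for the crux (`e - g φ` not larger, up to `ε`) and is `ε`-equilibrated at every
`ρ`-robust site. -/
def DescentToEquilibria : Prop :=
  ∀ g : ℝ, 0 ≤ g → ∀ P : PeriodicConfiguration 3, ∀ ε > (0 : ℝ), ∀ ρ > (0 : ℝ),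
    ∃ P' : PeriodicConfiguration 3,
      P'.lattice = P.lattice ∧ P'.motif.card = P.motif.card ∧
      P'.energyPerParticle lennardJones - g * defectFraction P' ≤
        P.energyPerParticle lennardJones - g * defectFraction P + ε ∧
      ∀ s ∈ P'.motif, Robust ρ P' s → ‖force P' s‖ ≤ ε

/-- The restricted crux: coercivity demanded only of `(ε, ρ)`-pinned equilibria. -/
def CruxOnEquilibria (g ε ρ : ℝ) : Prop :=
  ∀ P : PeriodicConfiguration 3, (∀ s ∈ P.motif, Robust ρ P s → ‖force P s‖ ≤ ε) →
    ePer + g * defectFraction P ≤ P.energyPerParticle lennardJones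

/-- **The reduction (pure logic given the descent lemma).** If the crux holds on
`(ε, ρ)`-pinned equilibria for some `g > 0`, it holds outright with the same `g`. -/
theorem reduction_to_equilibria (hD : DescentToEquilibria) {g ε ρ : ℝ} (hg : 0 < g) (hε : 0 < ε)
    (hρ : 0 < ρ) (hC : ∀ ε' : ℝ, 0 < ε' → ε' ≤ ε → CruxOnEquilibria g ε' ρ) : Crux := by
  refine ⟨g, hg, fun P => ?_⟩
  -- `e(P) - g φ(P) ≥ e(P') - g φ(P') - ε' ≥ ePer - ε'` for every small `ε'`
  refine le_of_forall_pos_lt_add fun δ hδ => ?_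
  obtain ⟨P', -, -, hle, hforce⟩ := hD g hg.le P (min δ ε / 2) (by positivity) ρ hρ
  have hε' : min δ ε / 2 ≤ ε := by
    have := min_le_right δ ε; linarith [hε]
  have hC' := hC (min δ ε / 2) (by positivity) hε' P' hforce
  have hmin : min δ ε / 2 < δ := by
    have := min_le_left δ ε; linarith
  linarith

/-- **One-site cuts (card 2, the structure every interior equilibrium carries).** At a motif point
where `P` is a local minimum in that point's coordinate alone (lattice fixed), the sublattice force
vanishes and the one-centre sum of the Laplacian `ΔV_LJ(r) = 11 r⁻¹⁴ - 5 r⁻⁸` over the other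
sublattices is non-negative (second-order necessary condition, trace of the `3 × 3` Hessian block):
valid linear constraints on the local statistics of every worst competitor. -/
def OneSiteCuts : Prop :=
  ∀ (P : PeriodicConfiguration 3) (s : E3), s ∈ P.motif →
    (∃ ρ > (0 : ℝ), ∀ P' : PeriodicConfiguration 3, P'.lattice = P.lattice →
        ∀ t : E3, dist t s < ρ → P'.motif = insert t (P.motif.erase s) →
          P.energyPerParticle lennardJones ≤ P'.energyPerParticle lennardJones) →
    force P s = 0 ∧
      0 ≤ ∑' y : {y : E3 // y ∈ P.points ∧ y - s ∉ P.lattice},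
        (11 * (dist s y.1)⁻¹ ^ 14 - 5 * (dist s y.1)⁻¹ ^ 8)

end Summit.AtomisticToContinuum.Crystallization.Cruxes.PeriodicStarCoercivity.Sketch

end
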